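import Summits.KontsevichZagierPeriods.KontsevichZagierPeriods.Theorems.GpcLegendreLemniscatic.Negative.Strengthenings

/-!
# `GpcLegendreLemniscatic` (stmt-KontsevichZagierPeriods-0280) — part 4: certified first move of the simplified chain

Support file for the crux `Grothendieck.GpcLegendreLemniscatic` (cdisprove seat, gen 1), on top of
parts 1 and 3 (`Canonical`, `Strengthenings`). POSITIVE content handed to provers: Lawden's
substitution `x = √(1 − t²)` (tree lemmas `lemniscaticK_subst_sqrt`, `lemniscaticE_subst_sqrt`)
realised as ONE rule-(2) move on each factor of `r₀ = [g]·[k]`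
(`unitRep_sub_unitRep_mem_changeOfVariablesRel`, a general one-dimensional change of variables
between unit-interval representations), glued by the tree's `KZ.Equivalent.prod`:
`equivalent_legendreRep_lemniscateRep : r₀ ~ [√2t²/√(1−t⁴)]·[√2/√(1−t⁴)]` and
`gpcLegendre_iff_lemniscate : GpcLegendreLemniscatic ↔ KZ.Equivalent lemniscateRep arctanRep`. No exact
term has to be cancelled (contrast McKean–Moll's `t² = 2x²/(1+x²)`); what remains is `u = t⁴`,
Dirichlet's two polynomial substitutions, one Newton–Leibniz move and the arctangent (≈ 7 moves).
[cite: Lawden1989, Ch. 3 Exercise 24 (hint)]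
-/

noncomputable section

open MeasureTheory Set
open Literature.NumberTheory.Transcendental
open Literature.NumberTheory.Transcendental.KZ
open Literature.ModelTheory.ExponentialFields (IsSemialgebraic)
open MvPolynomial (aeval X C)
open Summit.KontsevichZagierPeriods.KontsevichZagierPeriods.Theses.Grothendieck (GpcLegendreLemniscatic)

namespace Summit.KontsevichZagierPeriods.Grothendieck.GpcLegendreLemniscaticNegative

/-! ## §7 Certified first move of the SIMPLIFIED chain (positive content, evidence for provers)

Lawden's substitution `x = √(1 − t²)` (Ch. 3 Ex. 24 hint; tree lemmas `lemniscaticK_subst_sqrt`,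
`lemniscaticE_subst_sqrt`) sends `k(x)dx ↦ √2 dt/√(1−t⁴)` and `g(x)dx = (2e − k)(x)dx ↦ √2 t² dt/√(1−t⁴)`
EXACTLY — no exact `F′`-term appears (contrast McKean–Moll's `t² = 2x²/(1+x²)`, §6). So the chain
starts with ONE rule-(2) move in each factor (`Equivalent.prod` of the tree glues them):
`r₀ = [g]·[k] ~ [√2t²/√(1−t⁴)]·[√2/√(1−t⁴)]` (`equivalent_legendreRep_lemniscateRep`), and the crux is
EQUIVALENT to the purely lemniscatic statement `gpcLegendre_iff_lemniscate`. What remains for a prover: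
`u = t⁴` in each factor (rule 2), Dirichlet's two polynomial substitutions (rule 2, dimension 2), ONE
Newton–Leibniz move (`∫₀¹ s^{-3/4} ds = 4`, the minimum allowed by §3), and the arctangent
bookkeeping — about seven moves. -/

/-- A ONE-DIMENSIONAL CHANGE OF VARIABLES between unit-interval representations is a rule-(2) move:
`φ : (0,1) → (0,1)` semialgebraic, differentiable, injective and onto, `f = (g ∘ φ)·|φ′|`.
[cite: KontsevichZagier2001, §1.2 rule (2)] -/
theorem unitRep_sub_unitRep_mem_changeOfVariablesRel {φ φ' f g : ℝ → ℝ}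
    (hφ : IsSemialgebraicFunOn ℚ unitIoo (fun x => φ (x 0)))
    (hderiv : ∀ t ∈ Ioo (0:ℝ) 1, HasDerivAt φ (φ' t) t) (hinj : InjOn φ (Ioo 0 1))
    (himage : φ '' Ioo 0 1 = Ioo 0 1)
    (hf : IsSemialgebraicFunOn ℚ unitIoo (fun x => f (x 0))) (hfi : IntegrableOn f (Ioo 0 1))
    (hg : IsSemialgebraicFunOn ℚ unitIoo (fun x => g (x 0))) (hgi : IntegrableOn g (Ioo 0 1))
    (hfg : ∀ t ∈ Ioo (0:ℝ) 1, f t = g (φ t) * |φ' t|) :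
    of (unitRep f hf hfi) - of (unitRep g hg hgi) ∈ changeOfVariablesRel := by
  refine ⟨1, unitRep f hf hfi, unitRep g hg hgi, fun x _ => φ (x 0),
    fun x => φ' (x 0) • ContinuousLinearMap.id ℝ (Fin 1 → ℝ), ?_, ?_, ?_, ?_, ?_, rfl⟩
  · exact IsSemialgebraicMapOn.of_forall isSemialgebraic_unitIoo fun _ => hφ
  · intro x hx
    refine HasFDerivAt.hasFDerivWithinAt ?_
    refine hasFDerivAt_pi'' fun i => ?_
    have h1 : HasFDerivAt (fun y : Fin 1 → ℝ => φ (y 0))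
        ((ContinuousLinearMap.smulRight (1 : ℝ →L[ℝ] ℝ) (φ' (x 0))).comp (ContinuousLinearMap.proj 0)) x :=
      HasFDerivAt.comp x (hderiv (x 0) hx).hasFDerivAt (hasFDerivAt_apply 0 x)
    refine h1.congr_fderiv (ContinuousLinearMap.ext fun v => ?_)
    simp [Fin.fin_one_eq_zero i, mul_comm]
  · intro x hx y hy hxy
    have h0 : φ (x 0) = φ (y 0) := congrFun hxy 0
    have h1 : x 0 = y 0 := hinj hx hy h0
    funext i
    rw [Fin.fin_one_eq_zero i]
    exact h1
  · ext z
    constructor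
    · intro hz
      have hz' : z 0 ∈ φ '' Ioo 0 1 := by rw [himage]; exact hz
      obtain ⟨t, ht, hzt⟩ := hz'
      refine ⟨fun _ => t, ht, ?_⟩
      funext i
      rw [Fin.fin_one_eq_zero i]
      exact hzt
    · rintro ⟨x, hx, rfl⟩
      show φ (x 0) ∈ Ioo (0:ℝ) 1
      rw [← himage]
      exact mem_image_of_mem φ hx
  · intro x hx
    have hdet : (φ' (x 0) • ContinuousLinearMap.id ℝ (Fin 1 → ℝ)).det = φ' (x 0) := by
      simp [ContinuousLinearMap.det]
    show f (x 0) = g (φ (x 0)) * |(φ' (x 0) • ContinuousLinearMap.id ℝ (Fin 1 → ℝ)).det|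
    rw [hdet]
    exact hfg (x 0) hx

/-- `√(1 − t²) ∈ (0,1)` for `t ∈ (0,1)`. [folklore] -/
theorem sqrt_one_sub_sq_mem_Ioo {t : ℝ} (ht : t ∈ Ioo (0:ℝ) 1) : Real.sqrt (1 - t ^ 2) ∈ Ioo (0:ℝ) 1 := by
  refine ⟨Real.sqrt_pos.mpr (by nlinarith [ht.1, ht.2]), ?_⟩
  rw [Real.sqrt_lt' one_pos]
  nlinarith [ht.1, ht.2]

/-- `0 < 1 − t⁴` on `(0,1)`. [folklore] -/
theorem one_sub_pow_four_pos {t : ℝ} (ht : t ∈ Ioo (0:ℝ) 1) : 0 < 1 - t ^ 4 :=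
  sub_pos.mpr (pow_lt_one₀ ht.1.le ht.2 four_ne_zero)

/-- `d/dt √(1 − t²) = −t/√(1 − t²)` on `(0,1)`. [folklore] -/
theorem hasDerivAt_sqrt_one_sub_sq {t : ℝ} (ht : t ∈ Ioo (0:ℝ) 1) :
    HasDerivAt (fun t : ℝ => Real.sqrt (1 - t ^ 2)) (-(t / Real.sqrt (1 - t ^ 2))) t := by
  have h1 : HasDerivAt (fun t : ℝ => 1 - t ^ 2) (-(2 * t)) t := by
    simpa using (hasDerivAt_pow 2 t).const_sub 1
  have h2 := h1.sqrt (by nlinarith [ht.1, ht.2] : (1:ℝ) - t ^ 2 ≠ 0)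
  convert h2 using 1
  field_simp

/-- `t ↦ √(1 − t²)` is injective on `(0,1)`. [folklore] -/
theorem injOn_sqrt_one_sub_sq : InjOn (fun t : ℝ => Real.sqrt (1 - t ^ 2)) (Ioo 0 1) := by
  intro a ha b hb hab
  have ha' : 0 ≤ 1 - a ^ 2 := by nlinarith [ha.1, ha.2]
  have hb' : 0 ≤ 1 - b ^ 2 := by nlinarith [hb.1, hb.2]
  have h2 : Real.sqrt (1 - a ^ 2) ^ 2 = Real.sqrt (1 - b ^ 2) ^ 2 := by
    simp only at hab
    rw [hab]
  rw [Real.sq_sqrt ha', Real.sq_sqrt hb'] at h2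
  have h3 : a ^ 2 = b ^ 2 := by linarith
  exact (pow_left_inj₀ ha.1.le hb.1.le two_ne_zero).mp h3

/-- `t ↦ √(1 − t²)` maps `(0,1)` onto `(0,1)`. [folklore] -/
theorem image_sqrt_one_sub_sq : (fun t : ℝ => Real.sqrt (1 - t ^ 2)) '' Ioo (0:ℝ) 1 = Ioo 0 1 := by
  ext x
  constructor
  · rintro ⟨t, ht, rfl⟩
    exact sqrt_one_sub_sq_mem_Ioo ht
  · intro hx
    refine ⟨Real.sqrt (1 - x ^ 2), sqrt_one_sub_sq_mem_Ioo hx, ?_⟩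
    simp only
    rw [Real.sq_sqrt (by nlinarith [hx.1, hx.2]), sub_sub_cancel, Real.sqrt_sq hx.1.le]

/-- `|−t/√(1−t²)| = t/√(1−t²)` on `(0,1)`. [folklore] -/
theorem abs_deriv_sqrt_one_sub_sq {t : ℝ} (ht : t ∈ Ioo (0:ℝ) 1) :
    |(-(t / Real.sqrt (1 - t ^ 2)))| = t / Real.sqrt (1 - t ^ 2) := by
  rw [abs_neg, abs_of_pos (div_pos ht.1 (Real.sqrt_pos.mpr (by nlinarith [ht.1, ht.2])))]

/-- `√2` is algebraic. [folklore] -/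
theorem isAlgebraic_sqrt_two : IsAlgebraic ℚ (Real.sqrt 2) := by
  refine ⟨Polynomial.X ^ 2 - Polynomial.C 2, Polynomial.X_pow_sub_C_ne_zero two_pos 2, ?_⟩
  simp [Real.sq_sqrt (by norm_num : (0:ℝ) ≤ 2)]

/-- `ã(t) = √2/√(1 − t⁴)`, the lemniscatic `A`-integrand (`∫₀¹ ã = K(1/√2)`). [cite: Lawden1989, §4.3 eqs. (4.3.2)–(4.3.6)] -/
def aTilde (t : ℝ) : ℝ := Real.sqrt 2 / Real.sqrt (1 - t ^ 4)

/-- `s̃(t) = √2 t²/√(1 − t⁴)`, the lemniscatic `B`-integrand (`∫₀¹ s̃ = 2E(1/√2) − K(1/√2)`). [folklore] -/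
def sTilde (t : ℝ) : ℝ := Real.sqrt 2 * t ^ 2 / Real.sqrt (1 - t ^ 4)

/-- `x ↦ 1 − x₀⁴` is semialgebraic on `unitIoo`. [folklore] -/
theorem isSemialgebraicFunOn_one_sub_pow_four :
    IsSemialgebraicFunOn ℚ unitIoo (fun x => 1 - x 0 ^ 4) := by
  have := isSemialgebraicFunOn_aeval isSemialgebraic_unitIoo (1 - X 0 ^ 4 : MvPolynomial (Fin 1) ℚ)
  refine this.congr fun x _ => ?_
  simp

/-- `x ↦ ã(x₀)` is semialgebraic on `unitIoo`. [folklore] -/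
theorem isSemialgebraicFunOn_aTilde : IsSemialgebraicFunOn ℚ unitIoo (fun x => aTilde (x 0)) := by
  have hc := isSemialgebraicFunOn_const_of_isAlgebraic isSemialgebraic_unitIoo isAlgebraic_sqrt_two
  have hd := IsSemialgebraicFunOn.sqrt_holds isSemialgebraicFunOn_one_sub_pow_four
  refine ((hc.div hd) fun x hx => ?_).congr fun x _ => ?_
  · exact (Real.sqrt_pos.2 (one_sub_pow_four_pos hx)).ne'
  · simp [aTilde]

/-- `x ↦ s̃(x₀)` is semialgebraic on `unitIoo`. [folklore] -/
theorem isSemialgebraicFunOn_sTilde : IsSemialgebraicFunOn ℚ unitIoo (fun x => sTilde (x 0)) := by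
  have hc := isSemialgebraicFunOn_const_of_isAlgebraic isSemialgebraic_unitIoo isAlgebraic_sqrt_two
  have hsq : IsSemialgebraicFunOn ℚ unitIoo (fun x => x 0 ^ 2) := by
    have := isSemialgebraicFunOn_aeval isSemialgebraic_unitIoo (X 0 ^ 2 : MvPolynomial (Fin 1) ℚ)
    exact this.congr fun x _ => by simp
  have hn := IsSemialgebraicFunOn.mul_holds hc hsq
  have hd := IsSemialgebraicFunOn.sqrt_holds isSemialgebraicFunOn_one_sub_pow_four
  refine ((hn.div hd) fun x hx => ?_).congr fun x _ => ?_
  · exact (Real.sqrt_pos.2 (one_sub_pow_four_pos hx)).ne'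
  · simp [sTilde]

/-- Domination `√(1 − t²) ≤ √(1 − t⁴)` on `(0,1)`. [folklore] -/
theorem sqrt_one_sub_sq_le_sqrt_one_sub_pow_four {t : ℝ} (ht : t ∈ Ioo (0:ℝ) 1) :
    Real.sqrt (1 - t ^ 2) ≤ Real.sqrt (1 - t ^ 4) := by
  apply Real.sqrt_le_sqrt
  have h2 : t ^ 2 ≤ 1 := by nlinarith [ht.1, ht.2]
  nlinarith [mul_le_mul_of_nonneg_left h2 (sq_nonneg t)]

/-- `ã` and `s̃` are integrable on `(0,1)` (both `≤ √2/√(1 − t²)`). [folklore] -/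
theorem integrableOn_aTilde_sTilde :
    IntegrableOn aTilde (Ioo 0 1) ∧ IntegrableOn sTilde (Ioo 0 1) := by
  have hdom : IntegrableOn (fun t => Real.sqrt 2 * aFun t) (Ioo 0 1) := integrableOn_aFun.const_mul _
  have hbound : ∀ t ∈ Ioo (0:ℝ) 1, ∀ c : ℝ, 0 ≤ c → c ≤ 1 →
      ‖Real.sqrt 2 * c / Real.sqrt (1 - t ^ 4)‖ ≤ Real.sqrt 2 * aFun t := by
    intro t ht c hc0 hc1
    have h1 : 0 < Real.sqrt (1 - t ^ 2) := Real.sqrt_pos.2 (by nlinarith [ht.1, ht.2])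
    have h2 : 0 < Real.sqrt (1 - t ^ 4) := Real.sqrt_pos.2 (one_sub_pow_four_pos ht)
    rw [Real.norm_eq_abs, abs_of_nonneg (by positivity), aFun, mul_one_div]
    calc Real.sqrt 2 * c / Real.sqrt (1 - t ^ 4) ≤ Real.sqrt 2 / Real.sqrt (1 - t ^ 4) := by
          apply div_le_div_of_nonneg_right _ h2.le
          nlinarith [Real.sqrt_nonneg 2]
      _ ≤ Real.sqrt 2 / Real.sqrt (1 - t ^ 2) :=
          div_le_div_of_nonneg_left (Real.sqrt_nonneg 2) h1 (sqrt_one_sub_sq_le_sqrt_one_sub_pow_four ht)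
  have hmeasA : AEStronglyMeasurable aTilde (volume.restrict (Ioo (0:ℝ) 1)) := by
    refine ContinuousOn.aestronglyMeasurable ?_ measurableSet_Ioo
    unfold aTilde
    refine ContinuousOn.div (by fun_prop) (by fun_prop) fun t ht => ?_
    exact (Real.sqrt_pos.2 (one_sub_pow_four_pos ht)).ne'
  have hmeasS : AEStronglyMeasurable sTilde (volume.restrict (Ioo (0:ℝ) 1)) := by
    refine ContinuousOn.aestronglyMeasurable ?_ measurableSet_Ioo
    unfold sTilde
    refine ContinuousOn.div (by fun_prop) (by fun_prop) fun t ht => ?_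
    exact (Real.sqrt_pos.2 (one_sub_pow_four_pos ht)).ne'
  constructor
  · refine hdom.mono' hmeasA ?_
    refine (ae_restrict_mem measurableSet_Ioo).mono fun t ht => ?_
    have := hbound t ht 1 zero_le_one le_rfl
    rw [mul_one] at this
    exact this
  · refine hdom.mono' hmeasS ?_
    refine (ae_restrict_mem measurableSet_Ioo).mono fun t ht => ?_
    exact hbound t ht (t ^ 2) (sq_nonneg t) (by nlinarith [ht.1, ht.2])

/-- `[(0,1), ã]`, value `K(1/√2)` (the lemniscatic `√2·∫dt/√(1−t⁴)`). [folklore] -/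
def aTildeRep : IntegralRep 1 := unitRep aTilde isSemialgebraicFunOn_aTilde integrableOn_aTilde_sTilde.1

/-- `[(0,1), s̃]`, value `2E − K`. [folklore] -/
def sTildeRep : IntegralRep 1 := unitRep sTilde isSemialgebraicFunOn_sTilde integrableOn_aTilde_sTilde.2

/-- After `x = √(1 − t²)`, `g(x)dx` becomes `√2 t² dt/√(1 − t⁴)` EXACTLY (from the tree's two
substitution identities and `g = 2e − k`). [cite: Lawden1989, Ch. 3 Exercise 24 (hint)] -/
theorem gFun_subst_sqrt {t : ℝ} (ht : t ∈ Ioo (0:ℝ) 1) :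
    t / Real.sqrt (1 - t ^ 2) * gFun (Real.sqrt (1 - t ^ 2)) = sTilde t := by
  have hK := Literature.Analysis.SpecialFunctions.lemniscaticK_subst_sqrt ht
  have hE := Literature.Analysis.SpecialFunctions.lemniscaticE_subst_sqrt ht
  rw [gFun_eq (sqrt_one_sub_sq_mem_Ioo ht)]
  unfold eFun kFun
  unfold sTilde
  have hs : 0 < Real.sqrt (1 - t ^ 4) := Real.sqrt_pos.2 (one_sub_pow_four_pos ht)
  have hr : 0 < Real.sqrt 2 := Real.sqrt_pos.2 two_pos
  have hr2 : Real.sqrt 2 ^ 2 = 2 := Real.sq_sqrt two_pos.le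
  calc t / Real.sqrt (1 - t ^ 2) *
        (2 * (Real.sqrt (1 - Real.sqrt (1 - t ^ 2) ^ 2 / 2) / Real.sqrt (1 - Real.sqrt (1 - t ^ 2) ^ 2)) -
          1 / Real.sqrt ((1 - Real.sqrt (1 - t ^ 2) ^ 2) * (1 - Real.sqrt (1 - t ^ 2) ^ 2 / 2)))
        = 2 * (t / Real.sqrt (1 - t ^ 2) *
            (Real.sqrt (1 - Real.sqrt (1 - t ^ 2) ^ 2 / 2) / Real.sqrt (1 - Real.sqrt (1 - t ^ 2) ^ 2))) -
          t / Real.sqrt (1 - t ^ 2) *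
            (1 / Real.sqrt ((1 - Real.sqrt (1 - t ^ 2) ^ 2) * (1 - Real.sqrt (1 - t ^ 2) ^ 2 / 2))) := by
          ring
    _ = 2 * ((1 + t ^ 2) / (Real.sqrt 2 * Real.sqrt (1 - t ^ 4))) - Real.sqrt 2 / Real.sqrt (1 - t ^ 4) := by
          rw [hE, hK]
    _ = Real.sqrt 2 * t ^ 2 / Real.sqrt (1 - t ^ 4) := by
          field_simp
          linear_combination (-(1 + t ^ 2)) * hr2

/-- After `x = √(1 − t²)`, `k(x)dx` becomes `√2 dt/√(1 − t⁴)`. [cite: Lawden1989, §4.3 eqs. (4.3.2)–(4.3.6)] -/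
theorem kFun_subst_sqrt {t : ℝ} (ht : t ∈ Ioo (0:ℝ) 1) :
    t / Real.sqrt (1 - t ^ 2) * kFun (Real.sqrt (1 - t ^ 2)) = aTilde t :=
  Literature.Analysis.SpecialFunctions.lemniscaticK_subst_sqrt ht

/-- **Move 1 on the `k`-factor**: `[(0,1), ã] − [(0,1), k]` is ONE rule-(2) move (`x = √(1−t²)`). [cite: KontsevichZagier2001, §1.2 rule (2)] -/
theorem aTildeRep_sub_kRep_mem_changeOfVariablesRel : of aTildeRep - of kRep ∈ changeOfVariablesRel := by
  refine unitRep_sub_unitRep_mem_changeOfVariablesRel (φ := fun t => Real.sqrt (1 - t ^ 2))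
    (φ' := fun t => -(t / Real.sqrt (1 - t ^ 2)))
    (IsSemialgebraicFunOn.sqrt_holds isSemialgebraicFunOn_one_sub_sq)
    (fun t ht => hasDerivAt_sqrt_one_sub_sq ht) injOn_sqrt_one_sub_sq image_sqrt_one_sub_sq
    _ _ _ _ fun t ht => ?_
  rw [abs_deriv_sqrt_one_sub_sq ht, mul_comm, kFun_subst_sqrt ht]

/-- **Move 1 on the `g`-factor**: `[(0,1), s̃] − [(0,1), g]` is ONE rule-(2) move (`x = √(1−t²)`). [cite: KontsevichZagier2001, §1.2 rule (2)] -/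
theorem sTildeRep_sub_gRep_mem_changeOfVariablesRel : of sTildeRep - of gRep ∈ changeOfVariablesRel := by
  refine unitRep_sub_unitRep_mem_changeOfVariablesRel (φ := fun t => Real.sqrt (1 - t ^ 2))
    (φ' := fun t => -(t / Real.sqrt (1 - t ^ 2)))
    (IsSemialgebraicFunOn.sqrt_holds isSemialgebraicFunOn_one_sub_sq)
    (fun t ht => hasDerivAt_sqrt_one_sub_sq ht) injOn_sqrt_one_sub_sq image_sqrt_one_sub_sq
    _ _ _ _ fun t ht => ?_
  rw [abs_deriv_sqrt_one_sub_sq ht, mul_comm, gFun_subst_sqrt ht]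

/-- **The lemniscatic product representation** `[s̃]·[ã] = [(0,1)², 2t₀²/(√(1−t₀⁴)√(1−t₁⁴))]`. [folklore] -/
def lemniscateRep : IntegralRep 2 := sTildeRep.prod aTildeRep

/-- **`r₀ ~ [s̃]·[ã]` by two rule-(2) moves** (glued by the tree's `Equivalent.prod`, i.e. the proved
left/right ideal property of `KZ.relations`). [folklore] -/
theorem equivalent_legendreRep_lemniscateRep : Equivalent legendreRep lemniscateRep := by
  have hg : Equivalent sTildeRep gRep :=
    changeOfVariablesRel_subset_relations sTildeRep_sub_gRep_mem_changeOfVariablesRel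
  have hk : Equivalent aTildeRep kRep :=
    changeOfVariablesRel_subset_relations aTildeRep_sub_kRep_mem_changeOfVariablesRel
  exact Equivalent.prod hg.symm hk.symm

/-- The domain of `[s̃]·[ã]` is `(0,1)²`. [folklore] -/
theorem lemniscateRep_domain : lemniscateRep.domain = unitSq := prod_unitRep_domain _ _ _ _ _ _

/-- The integrand of `[s̃]·[ã]` is `s̃(t₀)·ã(t₁) = 2t₀²/(√(1−t₀⁴)√(1−t₁⁴))`. [folklore] -/
theorem lemniscateRep_integrand_apply (x : Fin 2 → ℝ) :
    lemniscateRep.integrand x = 2 * x 0 ^ 2 / (Real.sqrt (1 - x 0 ^ 4) * Real.sqrt (1 - x 1 ^ 4)) := by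
  rw [show lemniscateRep = sTildeRep.prod aTildeRep from rfl, sTildeRep, aTildeRep, prod_unitRep_integrand_apply]
  unfold sTilde aTilde
  have hr2 : Real.sqrt 2 * Real.sqrt 2 = 2 := Real.mul_self_sqrt two_pos.le
  rw [div_mul_div_comm, show Real.sqrt 2 * x 0 ^ 2 * Real.sqrt 2 = 2 * x 0 ^ 2 by linear_combination x 0 ^ 2 * hr2]

/-- **Value**: `∫₀¹ √2t²/√(1−t⁴) · ∫₀¹ √2/√(1−t⁴) = π/2` — Euler's 1738 identity
`∫₀¹dt/√(1−t⁴)·∫₀¹t²dt/√(1−t⁴) = π/4`, here obtained from Legendre's relation by the SOUNDNESS of two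
moves. [cite: Lawden1989, §4.3 eqs. (4.3.2)–(4.3.6)] -/
theorem lemniscateRep_value : lemniscateRep.value = Real.pi / 2 :=
  (Equivalent.value_eq_holds equivalent_legendreRep_lemniscateRep).symm.trans legendreRep_value

/-- **The crux in lemniscatic form**: `GpcLegendreLemniscatic ↔ [s̃]·[ã] ~ [ℝ, 1/(2(1+x²))]` — what
remains is `u = t⁴`, Dirichlet's two substitutions, one Newton–Leibniz move and the arctangent. [folklore] -/
theorem gpcLegendre_iff_lemniscate : GpcLegendreLemniscatic ↔ Equivalent lemniscateRep arctanRep := by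
  rw [gpcLegendre_iff]
  exact ⟨fun h => equivalent_legendreRep_lemniscateRep.symm.trans h,
    fun h => equivalent_legendreRep_lemniscateRep.trans h⟩


end Summit.KontsevichZagierPeriods.Grothendieck.GpcLegendreLemniscaticNegative
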